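import Mathlib
import HarnessLib
import Summits.HubbardSuperconductivity.HubbardSuperconductivity.Theorems.KLProgrammeKLRegimeWickSmearingDefect

/-!
# Route `KLProgramme` — crux K3, ENGINE child (stmt-HubbardSuperconductivity-20437 `KLRegimeEngineV17F2`), stub `stub_engine_step_values`, conjunct (E2-F2):
# SMEARING / TADPOLES OF A CROSS-LINE TERM — `Δ_E dblFold(T(a⁰b¹)) = dblFold(T((Δ_E a)⁰b¹)) + dblFold(T(a⁰(Δ_E b)¹)) + dblFold(Δ_×(E)T(a⁰b¹))`

Cell gate-hubbard-kl, seat hubbard-kl-p1 (g11; (E2) Wick-toolkit lane).  E2-GRIDPOINT-NOTE (evidence #23 on 20437) §5: the grid-point transfer / dressing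
weights of stub (c) are produced, inside slice `n`, by the SEXTIC kernel born in the slice — the 6-leg output of the one-line cross term `dblFold(Δ_×(C)(𝒲⁰𝒲¹))`
— read through a tadpole (soft line `D_n` for the transfer `T_n`, defect line `E` for the (R1′) defect; `…WickSmearingDefect`, p536297).  This file shows, by
transporting the Laplacian through the fold (`grassmannLaplacian_map`), that such a tadpole NEVER needs the 6-leg kernel: for any operator `T` on the doubled
algebra commuting with the two diagonal-block Laplacians (every cross-line operator `Δ_×(C)`, their products and exponentials does),

  `Δ_E (dblFold (T (a⁰·b¹))) = dblFold (T ((Δ_E a)⁰·b¹)) + dblFold (T (a⁰·(Δ_E b)¹)) + dblFold (Δ_×(E) (T (a⁰·b¹)))`      (`a` even)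

(`grassmannLaplacian_dblFold_of_commute`; instances `…_crossLaplacian` for `T = Δ_×(C)`, `…_crossLaplacian_pow` for `T = Δ_×(C)^k`): the tadpole of a
`k`-cross-line graph = the same graph with the tadpole on either VERTEX + the graph with ONE MORE cross line `E` — for `k = 1` at four legs: two one-line
(leg-dressing-shaped) terms (`kernel_dblFold_oneLine`, p504589) and the `(E, C)` BUBBLE `dblFold(Δ_×(E)Δ_×(C)(a⁰b¹))`, whose three-channel reading at the pair
labels is `vertexFnW_dblFold_bubble_pairLabels` / `_general` (p511598 / p514147): pp part `= −c₄⁻²·K·diag(λ_{E,C})·K` — the MIXED RUNG with line pair `(E, C)`,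
i.e. exactly the resummation-shaped production term of the transfer weight (TRANSFER-NOTE §1 `t`-profile) resp. of the (R1′) defect weight.  §2 reads the
identity at the vertex-function level and, with `vertexFn_grassmannLaplacian_normalCovariance'`, as the statement «`(βL²)⁻²Σ_{kσ} e(kσ)·𝒱_{m+2}(dblFold(Δ_×(C)(W⁰W¹)))
(Z, ψ̂⁻_{kσ}, ψ̂⁺_{kσ})` = the three four-leg terms» (`vertexFn_tadpole_dblFold_crossLaplacian`).  The all-orders (Gaussian) version
`gaussConv_dblFold_crossLaplacian` (`e^{Δ_E}dblFold(Δ_×(C)(a⁰b¹)) = dblFold(Δ_×(C) e^{Δ_×(E)}((e^{Δ_E}a)⁰(e^{Δ_E}b)¹))`) is the form the (R1′) defect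
`(e^{Δ_E} − 1)` and the transfer `(e^{Δ_{D_n}} − 1)` use.  Exact algebra over tree lemmas; nothing about sizes or superconductivity is asserted.  0 kit.
-/

noncomputable section

namespace Summit.HubbardSuperconductivity.HubbardSuperconductivity.Theorems.KLRegimeWick

set_option linter.dupNamespace false -- summit = problem name (single-conjunct summit), D-0017

open Literature.MathematicalPhysics.QuantumLattice GrassmannAlgebra Finset Matrix
open Literature.Probability.LatticeModels Summit.HubbardSuperconductivity.HubbardSuperconductivity.Theorems.KLProgrammeLegKernels
open Summit.HubbardSuperconductivity.HubbardSuperconductivity.Theorems.KLRegimeSplit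

/-! ## §1 Generic: transporting a Laplacian through the fold of two copies -/

section Generic

variable (R : Type*) [CommRing R] [Algebra ℚ R] {Γ : Type*} [Fintype Γ] [DecidableEq Γ]

/-- **`Δ_E ∘ dblFold = dblFold ∘ Δ_{Ẽ}`**, `Ẽ = dblCov E 0 0 + dblCov E 1 1 + crossCov E` (the fold pulls `E` back to all four blocks;
the Laplacian twin of `gaussConv_dblFold`). -/
theorem grassmannLaplacian_dblFold (E : Matrix Γ Γ R) (F : GrassmannAlgebra R (Γ × Fin 2)) :
    grassmannLaplacian R E (dblFold R F) =
      dblFold R (grassmannLaplacian R (dblCov R E 0 0 + dblCov R E 1 1 + crossCov R E) F) := by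
  rw [dblFold, grassmannLaplacian_map, LinearMap.toMatrix'_toLin', dblProjMat_transpose_mul_mul]

/-- **The diagonal block acts on its own copy as `E`**: `Δ_{dblCov E s s}(dblCopy s a) = dblCopy s (Δ_E a)`. -/
theorem grassmannLaplacian_dblCov_dblCopy (s : Fin 2) (E : Matrix Γ Γ R) (a : GrassmannAlgebra R Γ) :
    grassmannLaplacian R (dblCov R E s s) (dblCopy R s a) = dblCopy R s (grassmannLaplacian R E a) := by
  rw [dblCopy, grassmannLaplacian_map, LinearMap.toMatrix'_toLin', dblEmbMat_transpose_mul_dblCov_mul]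

/-- The block `00` differentiates copy `0` only: `Δ_{dblCov E 0 0}(a⁰·b¹) = (Δ_E a)⁰·b¹`. -/
theorem grassmannLaplacian_dblCov_zero_copy_mul_copy (E : Matrix Γ Γ R) (a b : GrassmannAlgebra R Γ) :
    grassmannLaplacian R (dblCov R E 0 0) (dblCopy R 0 a * dblCopy R 1 b) = dblCopy R 0 (grassmannLaplacian R E a) * dblCopy R 1 b := by
  have h10 : (1 : Fin 2) ≠ 0 := by decide
  rw [grassmannLaplacian_mul_eq_mul_of_mem_right R (dblCov R E 0 0) (fun p q h => dblCov_eq_zero_of_mem R h10 E p q h) _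
      (dblCopy_mem_fieldSubalgebra R 1 b), grassmannLaplacian_dblCov_dblCopy]

/-- The block `11` differentiates copy `1` only: for `a` even, `Δ_{dblCov E 1 1}(a⁰·b¹) = a⁰·(Δ_E b)¹`. -/
theorem grassmannLaplacian_dblCov_one_copy_mul_copy (E : Matrix Γ Γ R) {a : GrassmannAlgebra R Γ} (ha : a ∈ evenOdd R 0) (b : GrassmannAlgebra R Γ) :
    grassmannLaplacian R (dblCov R E 1 1) (dblCopy R 0 a * dblCopy R 1 b) = dblCopy R 0 a * dblCopy R 1 (grassmannLaplacian R E b) := by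
  have h01 : (0 : Fin 2) ≠ 1 := by decide
  rw [grassmannLaplacian_mul_eq_mul_of_mem R (dblCov R E 1 1) (fun p q h => dblCov_eq_zero_of_mem R h01 E p q h)
      (dblCopy_mem_fieldSubalgebra R 0 a) (dblCopy_mem_evenOdd_zero R 0 ha), grassmannLaplacian_dblCov_dblCopy]

/-- **Tadpole of a cross-line term.**  For an operator `T` on the doubled algebra commuting with both diagonal-block Laplacians of `E` and an even `a`:
`Δ_E (dblFold (T (a⁰·b¹))) = dblFold (T ((Δ_E a)⁰·b¹)) + dblFold (T (a⁰·(Δ_E b)¹)) + dblFold (Δ_×(E) (T (a⁰·b¹)))` — the tadpole sits on vertex `a`, or on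
vertex `b`, or is one more CROSS line. -/
theorem grassmannLaplacian_dblFold_of_commute (E : Matrix Γ Γ R) (T : Module.End R (GrassmannAlgebra R (Γ × Fin 2)))
    (h0 : Commute (grassmannLaplacian R (dblCov R E 0 0)) T) (h1 : Commute (grassmannLaplacian R (dblCov R E 1 1)) T)
    {a : GrassmannAlgebra R Γ} (ha : a ∈ evenOdd R 0) (b : GrassmannAlgebra R Γ) :
    grassmannLaplacian R E (dblFold R (T (dblCopy R 0 a * dblCopy R 1 b))) =
      dblFold R (T (dblCopy R 0 (grassmannLaplacian R E a) * dblCopy R 1 b)) +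
        dblFold R (T (dblCopy R 0 a * dblCopy R 1 (grassmannLaplacian R E b))) +
        dblFold R (grassmannLaplacian R (crossCov R E) (T (dblCopy R 0 a * dblCopy R 1 b))) := by
  have e0 : grassmannLaplacian R (dblCov R E 0 0) (T (dblCopy R 0 a * dblCopy R 1 b)) = T (grassmannLaplacian R (dblCov R E 0 0) (dblCopy R 0 a * dblCopy R 1 b)) :=
    congrFun (congrArg DFunLike.coe h0.eq) _
  have e1 : grassmannLaplacian R (dblCov R E 1 1) (T (dblCopy R 0 a * dblCopy R 1 b)) = T (grassmannLaplacian R (dblCov R E 1 1) (dblCopy R 0 a * dblCopy R 1 b)) :=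
    congrFun (congrArg DFunLike.coe h1.eq) _
  rw [grassmannLaplacian_dblFold, grassmannLaplacian_add, grassmannLaplacian_add, LinearMap.add_apply, LinearMap.add_apply, map_add, map_add, e0, e1,
    grassmannLaplacian_dblCov_zero_copy_mul_copy, grassmannLaplacian_dblCov_one_copy_mul_copy R E ha]

omit [DecidableEq Γ] in
/-- Cross-line Laplacians commute with the diagonal blocks (all Laplacians commute). -/
theorem commute_dblCov_crossLaplacian_pow (E C : Matrix Γ Γ R) (s : Fin 2) (k : ℕ) :
    Commute (grassmannLaplacian R (dblCov R E s s)) (grassmannLaplacian R (crossCov R C) ^ k) :=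
  (commute_grassmannLaplacian R (dblCov R E s s) (crossCov R C)).pow_right k

/-- **Tadpole of the ONE-line cross term**: `Δ_E dblFold(Δ_×(C)(a⁰b¹)) = dblFold(Δ_×(C)((Δ_E a)⁰b¹)) + dblFold(Δ_×(C)(a⁰(Δ_E b)¹)) + dblFold(Δ_×(E)Δ_×(C)(a⁰b¹))` —
two one-line terms with a tadpole-dressed vertex and the `(E, C)` BUBBLE. -/
theorem grassmannLaplacian_dblFold_crossLaplacian (E C : Matrix Γ Γ R) {a : GrassmannAlgebra R Γ} (ha : a ∈ evenOdd R 0) (b : GrassmannAlgebra R Γ) :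
    grassmannLaplacian R E (dblFold R (grassmannLaplacian R (crossCov R C) (dblCopy R 0 a * dblCopy R 1 b))) =
      dblFold R (grassmannLaplacian R (crossCov R C) (dblCopy R 0 (grassmannLaplacian R E a) * dblCopy R 1 b)) +
        dblFold R (grassmannLaplacian R (crossCov R C) (dblCopy R 0 a * dblCopy R 1 (grassmannLaplacian R E b))) +
        dblFold R (grassmannLaplacian R (crossCov R E) (grassmannLaplacian R (crossCov R C) (dblCopy R 0 a * dblCopy R 1 b))) := by
  have h0 := commute_dblCov_crossLaplacian_pow R E C 0 1
  have h1 := commute_dblCov_crossLaplacian_pow R E C 1 1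
  rw [pow_one] at h0 h1
  exact grassmannLaplacian_dblFold_of_commute R E _ h0 h1 ha b

/-- **Tadpole of the `k`-line cross term** (`T = Δ_×(C)^k`): the same three terms. -/
theorem grassmannLaplacian_dblFold_crossLaplacian_pow (E C : Matrix Γ Γ R) (k : ℕ) {a : GrassmannAlgebra R Γ} (ha : a ∈ evenOdd R 0)
    (b : GrassmannAlgebra R Γ) :
    grassmannLaplacian R E (dblFold R ((grassmannLaplacian R (crossCov R C) ^ k) (dblCopy R 0 a * dblCopy R 1 b))) =
      dblFold R ((grassmannLaplacian R (crossCov R C) ^ k) (dblCopy R 0 (grassmannLaplacian R E a) * dblCopy R 1 b)) +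
        dblFold R ((grassmannLaplacian R (crossCov R C) ^ k) (dblCopy R 0 a * dblCopy R 1 (grassmannLaplacian R E b))) +
        dblFold R (grassmannLaplacian R (crossCov R E) ((grassmannLaplacian R (crossCov R C) ^ k) (dblCopy R 0 a * dblCopy R 1 b))) :=
  grassmannLaplacian_dblFold_of_commute R E _ (commute_dblCov_crossLaplacian_pow R E C 0 k) (commute_dblCov_crossLaplacian_pow R E C 1 k) ha b

/-- **The all-orders (Gaussian) version for the one-line term**: `e^{Δ_E} dblFold(Δ_×(C)(a⁰b¹)) = dblFold(Δ_×(C)(e^{Δ_×(E)}((e^{Δ_E}a)⁰·(e^{Δ_E}b)¹)))` (`a` even)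
— smearing the output of a one-line graph = the one-line graph of the SMEARED vertices with, in addition, any number of `E` cross lines
(`gaussConv_dblFold`, the block convolutions `gaussConv_dblCov_dblCopy`, and `e^{Δ}`–`Δ` commutation). -/
theorem gaussConv_dblFold_crossLaplacian (E C : Matrix Γ Γ R) {a : GrassmannAlgebra R Γ} (ha : a ∈ evenOdd R 0) (b : GrassmannAlgebra R Γ) :
    gaussConv R E (dblFold R (grassmannLaplacian R (crossCov R C) (dblCopy R 0 a * dblCopy R 1 b))) =
      dblFold R (grassmannLaplacian R (crossCov R C)
        (gaussConv R (crossCov R E) (dblCopy R 0 (gaussConv R E a) * dblCopy R 1 (gaussConv R E b)))) := by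
  have h01 : (0 : Fin 2) ≠ 1 := by decide
  -- `e^{Δ}` of a block commutes with the cross Laplacian
  have hcomm : ∀ D : Matrix (Γ × Fin 2) (Γ × Fin 2) R, gaussConv R D ∘ₗ grassmannLaplacian R (crossCov R C) =
      grassmannLaplacian R (crossCov R C) ∘ₗ gaussConv R D := fun D =>
    Module.End.commute_exp_left_of_commute (isNilpotent_grassmannLaplacian R D) (isNilpotent_grassmannLaplacian R D)
      (commute_grassmannLaplacian R D (crossCov R C)).eq
  have happ : ∀ (D : Matrix (Γ × Fin 2) (Γ × Fin 2) R) (G : GrassmannAlgebra R (Γ × Fin 2)),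
      gaussConv R D (grassmannLaplacian R (crossCov R C) G) = grassmannLaplacian R (crossCov R C) (gaussConv R D G) := fun D G => by
    have h := congrFun (congrArg DFunLike.coe (hcomm D)) G
    simpa only [LinearMap.coe_comp, Function.comp_apply] using h
  have hea : gaussConv R E a ∈ evenOdd R 0 := gaussConv_mem_evenOdd R E ha
  rw [gaussConv_dblFold, add_comm (dblCov R E 0 0 + dblCov R E 1 1) (crossCov R E), gaussConv_add_apply, gaussConv_add_apply, happ, happ, happ,
    gaussConv_mul_eq_mul_of_mem R (dblCov R E 1 1) (fun p q h => dblCov_eq_zero_of_mem R h01 E p q h)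
      (dblCopy_mem_fieldSubalgebra R 0 a) (dblCopy_mem_evenOdd_zero R 0 ha),
    gaussConv_dblCov_dblCopy,
    gaussConv_mul_eq_mul_of_mem_right R (dblCov R E 0 0) (fun p q h => dblCov_eq_zero_of_mem R h01.symm E p q h) _
      (dblCopy_mem_fieldSubalgebra R 1 _),
    gaussConv_dblCov_dblCopy]

end Generic

/-! ## §2 Model: vertex functions, and the tadpole READING of the sextic output of the one-line term -/

section Model

variable (L M : ℕ) [NeZero L] {β : ℝ}

/-- **Vertex-function form** of `grassmannLaplacian_dblFold_crossLaplacian`: for an even `W : HubbardGrassmann L M` and lines `E` (tadpole) and `C` (cross),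
in every degree and at every label tuple,
`𝒱_m(Δ_E dblFold(Δ_×(C)(W⁰W¹)))(Z) = 𝒱_m(dblFold(Δ_×(C)((Δ_E W)⁰W¹)))(Z) + 𝒱_m(dblFold(Δ_×(C)(W⁰(Δ_E W)¹)))(Z) + 𝒱_m(dblFold(Δ_×(E)Δ_×(C)(W⁰W¹)))(Z)`;
at `m = 4` and the pair labels the last term is read by `vertexFnW_dblFold_bubble_pairLabels` / `vertexFnW_dblFold_bubble_general` (pp part = the mixed rung
with line pair `(E, C)`), the first two by `kernel_dblFold_oneLine` (leg-dressing shape: a two-leg kernel of one vertex on an external leg). -/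
theorem vertexFn_grassmannLaplacian_dblFold_crossLaplacian (E C : Matrix (HubbardFieldIdx L M) (HubbardFieldIdx L M) ℂ) {W : HubbardGrassmann L M}
    (hW : W ∈ evenOdd ℂ 0) (m : ℕ) (Z : Fin m → HubbardFieldIdx L M) :
    vertexFn L M β (grassmannLaplacian ℂ E (dblFold ℂ (grassmannLaplacian ℂ (crossCov ℂ C) (dblCopy ℂ 0 W * dblCopy ℂ 1 W)))) m Z =
      vertexFn L M β (dblFold ℂ (grassmannLaplacian ℂ (crossCov ℂ C) (dblCopy ℂ 0 (grassmannLaplacian ℂ E W) * dblCopy ℂ 1 W))) m Z +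
        vertexFn L M β (dblFold ℂ (grassmannLaplacian ℂ (crossCov ℂ C) (dblCopy ℂ 0 W * dblCopy ℂ 1 (grassmannLaplacian ℂ E W)))) m Z +
        vertexFn L M β (dblFold ℂ (grassmannLaplacian ℂ (crossCov ℂ E) (grassmannLaplacian ℂ (crossCov ℂ C) (dblCopy ℂ 0 W * dblCopy ℂ 1 W)))) m Z := by
  rw [grassmannLaplacian_dblFold_crossLaplacian ℂ E C hW W, vertexFn_add, vertexFn_add]

/-- **The tadpole READING of the one-line term's sextic output** (`0 < m`, `β ≠ 0`): for a normal tadpole line `E = normalCovariance e`,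
`(βL²)⁻²·Σ_{kσ} e(kσ)·𝒱_{m+2}(dblFold(Δ_×(C)(W⁰W¹)))(Z, ψ̂⁻_{kσ}, ψ̂⁺_{kσ}) =
   𝒱_m(dblFold(Δ_×(C)((Δ_E W)⁰W¹)))(Z) + 𝒱_m(dblFold(Δ_×(C)(W⁰(Δ_E W)¹)))(Z) + 𝒱_m(dblFold(Δ_×(E)Δ_×(C)(W⁰W¹)))(Z)`
(`vertexFn_grassmannLaplacian_normalCovariance'` read backwards): the soft / defect tadpole of the sextic kernel BORN in the slice (the 6-leg output of the
one-line cross term) never needs that kernel — it is two leg-dressed one-line terms plus the `(E, C)` bubble, all on quartic data of `W` and `Δ_E W`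
(E2-GRIDPOINT-NOTE §5: the production term of the transfer / (R1′) weight is ladder-shaped). -/
theorem vertexFn_tadpole_dblFold_crossLaplacian (hβ : β ≠ 0) (e : FreqMomentum L M × Fin 2 → ℂ)
    (C : Matrix (HubbardFieldIdx L M) (HubbardFieldIdx L M) ℂ) {W : HubbardGrassmann L M} (hW : W ∈ evenOdd ℂ 0) {m : ℕ} (hm : 0 < m)
    (Z : Fin m → HubbardFieldIdx L M) :
    ((((β * (L : ℝ) ^ 2) ^ 2 : ℝ) : ℂ))⁻¹ *
        ∑ p, e p * vertexFn L M β (dblFold ℂ (grassmannLaplacian ℂ (crossCov ℂ C) (dblCopy ℂ 0 W * dblCopy ℂ 1 W))) (m + 2)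
          (Fin.snoc (Fin.snoc Z ((p, 1) : HubbardFieldIdx L M) : Fin (m + 1) → HubbardFieldIdx L M) (p, 0)) =
      vertexFn L M β (dblFold ℂ (grassmannLaplacian ℂ (crossCov ℂ C)
          (dblCopy ℂ 0 (grassmannLaplacian ℂ (normalCovariance L M e) W) * dblCopy ℂ 1 W))) m Z +
        vertexFn L M β (dblFold ℂ (grassmannLaplacian ℂ (crossCov ℂ C)
          (dblCopy ℂ 0 W * dblCopy ℂ 1 (grassmannLaplacian ℂ (normalCovariance L M e) W)))) m Z +
        vertexFn L M β (dblFold ℂ (grassmannLaplacian ℂ (crossCov ℂ (normalCovariance L M e))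
          (grassmannLaplacian ℂ (crossCov ℂ C) (dblCopy ℂ 0 W * dblCopy ℂ 1 W)))) m Z := by
  rw [← vertexFn_grassmannLaplacian_normalCovariance' L M hβ e _ hm Z, vertexFn_grassmannLaplacian_dblFold_crossLaplacian L M _ C hW m Z]

end Model

end Summit.HubbardSuperconductivity.HubbardSuperconductivity.Theorems.KLRegimeWick

end
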